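import Mathlib.Algebra.Polynomial.Derivative
import Mathlib.Algebra.Polynomial.HasseDeriv
import Mathlib.Algebra.Ring.GeomSum
import Mathlib.Algebra.Field.ZMod
import Mathlib.Data.Fintype.Card
import Mathlib.Tactic.FieldSimp
import Mathlib.Tactic.LinearCombination
import Mathlib.Tactic.Ring
import Summits.BirchSwinnertonDyer.BirchSwinnertonDyer.Theorems.Rank2ShaFermatQuotientTaylor
import HarnessLib

/-!
# BirchSwinnertonDyer — rank-2 `Ш[p^∞]` cell, STRUCTURE track: the translation lemma on the cyclic class (T17a)
# and the affine-bijection step (T17b)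

HONEST FRAMING (cell `b2b-bsdr2sha`, run/shared/lean/b2b/bsd-rank2-sha/, structure/THEORY-NOTE-C5.md
supplement 17, (17.6) «TYPING TARGETS T17a / T17b»): ELEMENTARY congruences modulo `p³` / `p²` in an arbitrary
commutative ring about ONE polynomial `φ` whose reduction mod `p` is a polynomial in `X^p` (for the cell:
`φ = φ_p`, the `p`-th division polynomial), plus one line of linear algebra over a field (`ZMod p`). Nothing here
concerns BSD, `Ш`, heights, `L`-values or any census number; no definition, no named fact, no axiom. The
GEOMETRIC input of (17.1) — «translation by `B ∈ E₁(ℚ_p)` moves `x` by `p·τ(B)·ψ₂(S) + O(p²)`» — is NOT typed: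
it enters as the hypothesis `x' = x + p·a + p²·b` (read `a = τ(B)·ψ₂(S)`), exactly as in the companion file
`Rank2ShaFermatQuotientTaylor` (T14a), whose Taylor step `cube_dvd_eval_add_sub` is imported and reused.

WHAT (17.1) SAYS AND WHAT IS TYPED (T17a). T14a treats the SPLIT class (`FQ₁(u) = 0`, `u = φ(x_S)`); on the
CYCLIC class `u` is still a unit mod `p` but `u^{p−1} ≢ 1 (mod p²)`, and the note replaces the second Fermat
quotient by the logarithm `Λ(S) = (1/p)·log_p φ_p(x_S)`. The ring-level content is:
* `φ(x') ≡ u·(1 + p²·δ) (mod p³)` with `u·δ ≡ a·φ₁(x) (mod p)`, `φ'(x) = p·φ₁(x)` — the multiplicative form of the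
  Taylor step («`φ(x')·φ(x)⁻¹ ≡ 1 + p²·a·(φ'/p)(x)/φ(x)`» of (17.6)), no hypothesis on `FQ(u)`;
  [`cube_dvd_eval_sub_mul_one_add`, `…_of_frobenius_shape`]
* for ANY `n` and any `u'` with `u' ≡ u(1 + p²δ) (mod p³)`: `u'ⁿ ≡ uⁿ·(1 + n·p²·δ) (mod p³)`, and if `uⁿ ≡ 1 (mod p)`
  then `u'ⁿ ≡ uⁿ + n·p²·δ (mod p³)` [`cube_dvd_pow_sub_mul_of_shift`, `cube_dvd_pow_sub_add_of_shift`]; at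
  `n = p − 1`: **`φ(x')^{p−1} ≡ φ(x)^{p−1} − p²·δ (mod p³)`** — the two-digit Fermat quotient
  `z(u) := (u^{p−1} − 1)/p (mod p²)` shifts by `−p·δ` [`fermatQuotient_twoDigit_translation(_of_frobenius_shape)`];
* the LOG step as a polynomial identity: `(p−1)·log_p u = log_p(1 + p·z) ≡ p·z − p²·z²/2 (mod p³)`, so with
  `M(z) := 2z − p·z²` (twice the truncated `log_p(1 + p z)/p`) a shift `z' ≡ z − p·δ (mod p²)` gives
  `M(z') ≡ M(z) − 2p·δ (mod p²)` [`sq_dvd_truncLog_sub`] — i.e. `(p−1)·(Λ(S+B) − Λ(S)) ≡ −p·δ`, hence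
  `Λ(S+B) − Λ(S) ≡ p·δ = p·σ_E(S̃)·τ(B) (mod p²)` since `(p−1)⁻¹ ≡ −1 (mod p)`: the displayed line (17.1), with
  `δ = σ·τ`, `σ = φ₁(x_S)ψ₂(S)/φ(x_S)`. (The convergence of `log_p` and the identification of `Λ` with the engine's
  `Lambda_of` are analytic / conventional inputs and stay outside this file.)

(T17b) THE AFFINE-BIJECTION STEP of (17.4): over a field, for `D ≠ 0` the map `η ↦ D·η − c` is a bijection
[`affine_bijective`]; hence for every residue `r` there is exactly one `η` with `D·η − c = r` [`existsUnique_affine_eq`]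
and over `ZMod p` the fibre over each `r` has exactly one element out of `p` [`card_filter_affine_eq`] — the formal
content of «`U = D₋₁·η − ¼Δ₀²` is EXACTLY uniform on `𝔽_p` when `η` is, for fixed `(D₋₁ ≠ 0, Δ₀)`», i.e. of
«C1 on the cyclic class ⟸ η Haar». The Haar hypothesis on `η` itself is a density CONJECTURE of the note and is not
asserted anywhere here.

References: the cell's THEORY-NOTE-C5.md supplement 17 (LEAD g9, 2026-08-24); T14a = `Rank2ShaFermatQuotientTaylor`
(p372558), T15 = `Rank2ShaFermatQuotientLog` (p376124).
-/

set_option autoImplicit false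

-- single-conjunct summit: `Summit.BirchSwinnertonDyer.BirchSwinnertonDyer.…` repeats the name by design
set_option linter.dupNamespace false

open Polynomial

namespace Summit.BirchSwinnertonDyer.BirchSwinnertonDyer.Rank2Sha.Structure.LogTranslation

open Summit.BirchSwinnertonDyer.BirchSwinnertonDyer.Rank2Sha.Structure.TaylorFQ

variable {R : Type*} [CommRing R]

/-! ### T17a — the translation lemma, multiplicative / two-digit / truncated-log forms -/

/-- **Multiplicative Taylor step (17.6).** If every coefficient of `φ'` and of `D²φ` is divisible by `p`,
`φ'(x) = p·φ₁x`, `x' = x + p·a + p²·b`, and `δ` satisfies `φ(x)·δ ≡ a·φ₁x (mod p)` (i.e. `δ = a·φ₁(x)/φ(x)` when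
`φ(x)` is a unit mod `p`), then `φ(x') ≡ φ(x)·(1 + p²·δ) (mod p³)` — «`φ(x')·φ(x)⁻¹ ≡ 1 + p²·a·(φ'/p)(x)/φ(x)`».
No hypothesis on the Fermat quotient of `φ(x)` (cyclic AND split class). -/
theorem cube_dvd_eval_sub_mul_one_add (p : R) (φ : R[X]) (hD1 : ∀ i, p ∣ (derivative φ).coeff i)
    (hD2 : ∀ i, p ∣ (hasseDeriv 2 φ).coeff i) (x a b φ₁x δ : R)
    (hφ₁ : (derivative φ).eval x = p * φ₁x) (hδ : p ∣ φ.eval x * δ - a * φ₁x) :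
    p ^ 3 ∣ φ.eval (x + (p * a + p ^ 2 * b)) - φ.eval x * (1 + p ^ 2 * δ) := by
  obtain ⟨c, hc⟩ := cube_dvd_eval_add_sub p φ hD1 hD2 x a b
  obtain ⟨d, hd⟩ := hδ
  exact ⟨c - d, by linear_combination hc - p ^ 2 * hd + p * a * hφ₁⟩

/-- **Power shift, general form.** If `u' ≡ u·(1 + p²·δ) (mod p³)` then for every `n`,
`u'ⁿ ≡ uⁿ·(1 + n·p²·δ) (mod p³)`. -/
theorem cube_dvd_pow_sub_mul_of_shift (p u u' δ : R) (n : ℕ) (hu' : p ^ 3 ∣ u' - u * (1 + p ^ 2 * δ)) :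
    p ^ 3 ∣ u' ^ n - u ^ n * (1 + n * (p ^ 2 * δ)) := by
  obtain ⟨r, hr⟩ := exists_one_add_pow_eq (p ^ 2 * δ) n
  have h1 : p ^ 3 ∣ u' ^ n - (u * (1 + p ^ 2 * δ)) ^ n :=
    dvd_trans hu' (sub_dvd_pow_sub_pow u' (u * (1 + p ^ 2 * δ)) n)
  have h2 : p ^ 3 ∣ (u * (1 + p ^ 2 * δ)) ^ n - u ^ n * (1 + n * (p ^ 2 * δ)) :=
    ⟨u ^ n * r * p * δ ^ 2, by rw [mul_pow, hr]; ring⟩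
  have h12 := dvd_add h1 h2
  rwa [sub_add_sub_cancel] at h12

/-- **Power shift when `uⁿ ≡ 1 (mod p)`.** If `u' ≡ u·(1 + p²·δ) (mod p³)` and `p ∣ uⁿ − 1` then
`u'ⁿ ≡ uⁿ + n·p²·δ (mod p³)`: the shift is by `n·p²·δ` whatever the higher digits of `uⁿ` are. -/
theorem cube_dvd_pow_sub_add_of_shift (p u u' δ : R) (n : ℕ) (hu' : p ^ 3 ∣ u' - u * (1 + p ^ 2 * δ))
    (hu : p ∣ u ^ n - 1) :
    p ^ 3 ∣ u' ^ n - (u ^ n + n * (p ^ 2 * δ)) := by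
  obtain ⟨c, hc⟩ := cube_dvd_pow_sub_mul_of_shift p u u' δ n hu'
  obtain ⟨k, hk⟩ := hu
  exact ⟨c + k * n * δ, by linear_combination hc + n * p ^ 2 * δ * hk⟩

/-- **Two-digit Fermat quotient under translation** (T17a, general exponent). Hypotheses of
`cube_dvd_eval_sub_mul_one_add` and `p ∣ φ(x)ⁿ − 1`; conclusion `φ(x')ⁿ ≡ φ(x)ⁿ + n·p²·δ (mod p³)`. -/
theorem cube_dvd_eval_pow_translation (p : R) (φ : R[X]) (hD1 : ∀ i, p ∣ (derivative φ).coeff i)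
    (hD2 : ∀ i, p ∣ (hasseDeriv 2 φ).coeff i) (x a b φ₁x δ : R) (n : ℕ)
    (hφ₁ : (derivative φ).eval x = p * φ₁x) (hδ : p ∣ φ.eval x * δ - a * φ₁x)
    (hu : p ∣ (φ.eval x) ^ n - 1) :
    p ^ 3 ∣ (φ.eval (x + (p * a + p ^ 2 * b))) ^ n - ((φ.eval x) ^ n + n * (p ^ 2 * δ)) :=
  cube_dvd_pow_sub_add_of_shift p (φ.eval x) _ δ n
    (cube_dvd_eval_sub_mul_one_add p φ hD1 hD2 x a b φ₁x δ hφ₁ hδ) hu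

/-- **T17a at `n = p − 1`.** For a natural number `p ≥ 1` (cast into `R`), under the hypotheses of
`cube_dvd_eval_sub_mul_one_add` and `φ(x)^{p−1} ≡ 1 (mod p)` (i.e. `φ(x)` a unit of `ℤ/p`):
**`φ(x')^{p−1} ≡ φ(x)^{p−1} − p²·δ (mod p³)`** — the two-digit Fermat quotient `z = (u^{p−1} − 1)/p (mod p²)`
shifts by `−p·δ`, `δ = σ·τ(B)` (`a = τ(B)ψ₂(S)`, `σ = φ₁(x_S)ψ₂(S)/φ(x_S) = 2c(Ẽ,S̃)` by the slope lemma, untyped). -/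
theorem fermatQuotient_twoDigit_translation (p : ℕ) (hp : 1 ≤ p) (φ : R[X])
    (hD1 : ∀ i, (p : R) ∣ (derivative φ).coeff i) (hD2 : ∀ i, (p : R) ∣ (hasseDeriv 2 φ).coeff i)
    (x a b φ₁x δ : R) (hφ₁ : (derivative φ).eval x = p * φ₁x)
    (hδ : (p : R) ∣ φ.eval x * δ - a * φ₁x) (hu : (p : R) ∣ (φ.eval x) ^ (p - 1) - 1) :
    (p : R) ^ 3 ∣ (φ.eval (x + (p * a + (p : R) ^ 2 * b))) ^ (p - 1) -
      ((φ.eval x) ^ (p - 1) - (p : R) ^ 2 * δ) := by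
  obtain ⟨c, hc⟩ := cube_dvd_eval_pow_translation (p : R) φ hD1 hD2 x a b φ₁x δ (p - 1) hφ₁ hδ hu
  have hcast : ((p - 1 : ℕ) : R) = (p : R) - 1 := by
    rw [Nat.cast_sub hp, Nat.cast_one]
  rw [hcast] at hc
  exact ⟨c + δ, by linear_combination hc⟩

/-- **T17a with the note's hypotheses** (`p` odd, `φ ≡ A(X^p) (mod p)` coefficientwise): the two-digit Fermat
quotient of `φ(x_S)` drops by `p·σ·τ(B)` under translation by `B ∈ E₁`, `x(S+B) = x_S + p·τ(B)ψ₂(S) + O(p²)`. -/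
theorem fermatQuotient_twoDigit_translation_of_frobenius_shape (p : ℕ) (hp : Odd p) (φ : R[X])
    (hφ : ∀ i, ¬ p ∣ i → (p : R) ∣ φ.coeff i) (x a b φ₁x δ : R)
    (hφ₁ : (derivative φ).eval x = p * φ₁x) (hδ : (p : R) ∣ φ.eval x * δ - a * φ₁x)
    (hu : (p : R) ∣ (φ.eval x) ^ (p - 1) - 1) :
    (p : R) ^ 3 ∣ (φ.eval (x + (p * a + (p : R) ^ 2 * b))) ^ (p - 1) -
      ((φ.eval x) ^ (p - 1) - (p : R) ^ 2 * δ) :=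
  fermatQuotient_twoDigit_translation p hp.pos φ (dvd_coeff_derivative_of_frobenius_shape p φ hφ)
    (dvd_coeff_hasseDeriv_two_of_frobenius_shape p hp φ hφ) x a b φ₁x δ hφ₁ hδ hu

/-- **Multiplicative Taylor step with the note's hypotheses** (`p` odd, Frobenius shape):
`φ(x') ≡ φ(x)·(1 + p²δ) (mod p³)`, `φ(x)·δ ≡ a·φ₁(x) (mod p)`. -/
theorem cube_dvd_eval_sub_mul_one_add_of_frobenius_shape (p : ℕ) (hp : Odd p) (φ : R[X])
    (hφ : ∀ i, ¬ p ∣ i → (p : R) ∣ φ.coeff i) (x a b φ₁x δ : R)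
    (hφ₁ : (derivative φ).eval x = p * φ₁x) (hδ : (p : R) ∣ φ.eval x * δ - a * φ₁x) :
    (p : R) ^ 3 ∣ φ.eval (x + (p * a + (p : R) ^ 2 * b)) - φ.eval x * (1 + (p : R) ^ 2 * δ) :=
  cube_dvd_eval_sub_mul_one_add (p : R) φ (dvd_coeff_derivative_of_frobenius_shape p φ hφ)
    (dvd_coeff_hasseDeriv_two_of_frobenius_shape p hp φ hφ) x a b φ₁x δ hφ₁ hδ

/-- **The truncated-logarithm step.** With `M(z) := 2z − p·z²` (twice `log(1 + p z)/p` truncated modulo `p²`):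
if `z' ≡ z − p·δ (mod p²)` then `M(z') ≡ M(z) − 2p·δ (mod p²)`. Reading: `z, z'` the two-digit Fermat quotients
of `φ_p(x_S)`, `φ_p(x_{S+B})`; `(p−1)·Λ = log_p(1 + p z)/p ≡ M(z)/2 (mod p²)` for odd `p ≥ 5`; so
`(p−1)(Λ(S+B) − Λ(S)) ≡ −p·δ`, i.e. `Λ(S+B) − Λ(S) ≡ p·δ = p·σ_E(S̃)·τ(B) (mod p²)` — formula (17.1). -/
theorem sq_dvd_truncLog_sub (p z z' δ : R) (hz : p ^ 2 ∣ z' - (z - p * δ)) :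
    p ^ 2 ∣ (2 * z' - p * z' ^ 2) - ((2 * z - p * z ^ 2) - 2 * p * δ) := by
  obtain ⟨k, hk⟩ := hz
  have hz' : z' = z - p * δ + p ^ 2 * k := by linear_combination hk
  exact ⟨2 * k + 2 * z * δ - p * δ ^ 2 - p * k * (2 * (z - p * δ) + p ^ 2 * k), by rw [hz']; ring⟩

/-- **(17.1) assembled at ring level.** Write `u^{p−1} = 1 + p·z + p³·e` and `u'^{p−1} = 1 + p·z' + p³·e'`
(two-digit Fermat quotients `z, z'`, arbitrary tails), assume the two-digit shift `u'^{p−1} ≡ u^{p−1} − p²δ (mod p³)`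
(conclusion of `fermatQuotient_twoDigit_translation`), and assume `p·w ∈ (p³) ⟹ w ∈ (p²)` (hypothesis `hreg`;
automatic in `ℤ`, `ℤ_p`, kept explicit so the statement lives in any commutative ring). Then
`M(z') ≡ M(z) − 2p·δ (mod p²)`. -/
theorem sq_dvd_truncLog_translation (p U U' z z' e e' δ : R)
    (hreg : ∀ w : R, p ^ 3 ∣ p * w → p ^ 2 ∣ w)
    (hshift : p ^ 3 ∣ U' - (U - p ^ 2 * δ))
    (hz : U = 1 + p * z + p ^ 3 * e) (hz' : U' = 1 + p * z' + p ^ 3 * e') :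
    p ^ 2 ∣ (2 * z' - p * z' ^ 2) - ((2 * z - p * z ^ 2) - 2 * p * δ) := by
  refine sq_dvd_truncLog_sub p z z' δ (hreg _ ?_)
  obtain ⟨c, hc⟩ := hshift
  rw [hz, hz'] at hc
  exact ⟨c - e' + e, by linear_combination hc⟩

/-! ### T17b — the affine-bijection step of (17.4) -/

/-- **Affine bijection.** Over a field, for `D ≠ 0` the map `η ↦ D·η − c` is a bijection. (17.4): for fixed
`(D₋₁ ≠ 0, Δ₀)` the unit digit `U = D₋₁·η − ¼Δ₀²` of `Reg_H` is an affine-bijective image of the K-side digit `η`. -/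
theorem affine_bijective {F : Type*} [Field F] (D c : F) (hD : D ≠ 0) :
    Function.Bijective (fun η : F => D * η - c) := by
  constructor
  · intro η₁ η₂ h
    have h' : D * η₁ = D * η₂ := by
      have h0 : D * η₁ - c = D * η₂ - c := h
      linear_combination h0
    exact mul_left_cancel₀ hD h'
  · intro r
    refine ⟨D⁻¹ * (r + c), ?_⟩
    show D * (D⁻¹ * (r + c)) - c = r
    rw [← mul_assoc, mul_inv_cancel₀ hD, one_mul, add_sub_cancel_right]

/-- For `D ≠ 0` and every `r` there is exactly one `η` with `D·η − c = r`. -/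
theorem existsUnique_affine_eq {F : Type*} [Field F] (D c : F) (hD : D ≠ 0) (r : F) :
    ∃! η : F, D * η - c = r := by
  refine ⟨D⁻¹ * (r + c), ?_, fun η hη => ?_⟩
  · show D * (D⁻¹ * (r + c)) - c = r
    rw [← mul_assoc, mul_inv_cancel₀ hD, one_mul, add_sub_cancel_right]
  · have h1 : D * η = r + c := by linear_combination hη
    calc η = D⁻¹ * (D * η) := by rw [← mul_assoc, inv_mul_cancel₀ hD, one_mul]
      _ = D⁻¹ * (r + c) := by rw [h1]

/-- **Exact uniformity, counting form over `ZMod p`.** For a prime `p`, `D ≠ 0` and any `c, r ∈ ZMod p`, exactly ONE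
of the `p` residues `η` satisfies `D·η − c = r`: the fibres of `η ↦ D·η − c` all have size `1`, so the image of the
uniform (Haar) distribution on `η` is uniform — `P(U ≡ r) = 1/p` for every `r`, in particular `P(p ∣ Reg_H) = 1/p`
on the cyclic class GIVEN the Haar hypothesis on `η` (conjectural, not asserted here). -/
theorem card_filter_affine_eq (p : ℕ) [Fact p.Prime] (D c r : ZMod p) (hD : D ≠ 0) :
    (Finset.univ.filter (fun η : ZMod p => D * η - c = r)).card = 1 := by
  rw [Finset.card_eq_one]
  obtain ⟨η₀, hη₀, huniq⟩ := existsUnique_affine_eq D c hD r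
  refine ⟨η₀, Finset.ext fun η => ?_⟩
  simp only [Finset.mem_filter, Finset.mem_univ, true_and, Finset.mem_singleton]
  exact ⟨fun h => huniq η h, fun h => h ▸ hη₀⟩

/-- The total count: the `p` residues `η ∈ ZMod p` split into `p` fibres of size one (summing
`card_filter_affine_eq` over `r` recovers `Fintype.card (ZMod p) = p`). -/
theorem sum_card_filter_affine_eq (p : ℕ) [Fact p.Prime] (D c : ZMod p) (hD : D ≠ 0) :
    ∑ r : ZMod p, (Finset.univ.filter (fun η : ZMod p => D * η - c = r)).card = p := by
  simp only [card_filter_affine_eq p D c _ hD, Finset.sum_const, Finset.card_univ, ZMod.card, smul_eq_mul,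
    mul_one]

end Summit.BirchSwinnertonDyer.BirchSwinnertonDyer.Rank2Sha.Structure.LogTranslation
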